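import Summits.AnomalousDissipation.AnomalousDissipation.Theorems.SawtoothPulseCascadeLipAgmonPhase
import Summits.AnomalousDissipation.AnomalousDissipation.Theorems.SawtoothPulseCascadeApproxEnvelopeBox

/-!
# The Lipschitz envelope of the linearised cascade response from `K2″` alone, `ρN = 2`
(route `AnomalousDissipation/SawtoothPulseCascade`, line `lip-agmon` of the crux ApproxSol58 =
stmt-AnomalousDissipation-19688; lead g4, module F, part 2 — arithmetic of the closure)

`ratio_lt_of_mem_Icc` — the closure arithmetic of the line at `ρN = 2`: for `γ ∈ [5, 8]`, `r = γ² − 3` and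
any `μ < r`, `4μ · (4(16μ + (1+γ)²) + (1+γ+γ²)²) < r⁴`, i.e. `M₁ = √(R_Z R_V) < r²` with `R_Z = 4μ`,
`R_V = 64μ + 4(1+γ)² + (1+γ+γ²)²` (with `t = γ − 5 ∈ [0, 3]`:
`r³ − 256r − 16(1+γ)² − 4(1+γ+γ²)² = 596 + 9040t + 7048t² + 2232t³ + 362t⁴ + 30t⁵ + t⁶ > 0`).
`scale_eq` — `N_j/δ_j = 4·4^j` at the box point `⟨γ, ¼, 2, 1, 2⟩`.
-/

set_option linter.dupNamespace false

noncomputable section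

namespace Summit.AnomalousDissipation.AnomalousDissipation.Theorems.SawtoothPulseCascade.LipAgmon

open Set MeasureTheory
open scoped InnerProductSpace ContDiff
open Literature.Analysis Literature.Analysis.FunctionSpaces Literature.Analysis.FluidPDE
open Literature.Analysis.FluidPDE.Torus Literature.Analysis.FunctionSpaces.Torus
open Literature.Analysis.FluidPDE.SawtoothCascade Literature.Analysis.FluidPDE.SawtoothCascade.CascadeParams

/-- **Closure arithmetic at `ρN = 2`.** For `γ ∈ [5, 8]` and `μ < γ² − 3`, `0 ≤ μ`:
`4μ(4(16μ + (1+γ)²) + (1+γ+γ²)²) < (γ² − 3)⁴`. [folklore] -/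
theorem ratio_lt_of_mem_Icc {γ μ : ℝ} (hγ : γ ∈ Icc (5 : ℝ) 8) (hμ0 : 0 ≤ μ) (hμ : μ < γ ^ 2 - 3) :
    4 * μ * (4 * (16 * μ + (1 + γ) ^ 2) + (1 + γ + γ ^ 2) ^ 2) < ((γ ^ 2 - 3) ^ 2) ^ 2 := by
  set r := γ ^ 2 - 3 with hr
  set t := γ - 5 with ht
  have ht0 : 0 ≤ t := by rw [ht]; linarith [hγ.1]
  have hr22 : 22 ≤ r := by rw [hr]; nlinarith [hγ.1]
  have hr0 : 0 < r := by linarith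
  -- the polynomial margin
  have key : r ^ 3 - 256 * r - 16 * (1 + γ) ^ 2 - 4 * (1 + γ + γ ^ 2) ^ 2 =
      596 + 9040 * t + 7048 * t ^ 2 + 2232 * t ^ 3 + 362 * t ^ 4 + 30 * t ^ 5 + t ^ 6 := by
    have eγ : γ = 5 + t := by rw [ht]; ring
    rw [hr, eγ]; ring
  have hpos : 0 < r ^ 3 - 256 * r - 16 * (1 + γ) ^ 2 - 4 * (1 + γ + γ ^ 2) ^ 2 := by
    rw [key]; positivity
  have h1 : 4 * μ * (4 * (16 * μ + (1 + γ) ^ 2) + (1 + γ + γ ^ 2) ^ 2) ≤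
      4 * μ * (4 * (16 * r + (1 + γ) ^ 2) + (1 + γ + γ ^ 2) ^ 2) := by
    apply mul_le_mul_of_nonneg_left _ (by positivity); nlinarith
  have h2 : 4 * μ * (4 * (16 * r + (1 + γ) ^ 2) + (1 + γ + γ ^ 2) ^ 2) <
      4 * r * (4 * (16 * r + (1 + γ) ^ 2) + (1 + γ + γ ^ 2) ^ 2) := by
    have : 0 < 4 * (16 * r + (1 + γ) ^ 2) + (1 + γ + γ ^ 2) ^ 2 := by positivity
    nlinarith
  have h3 : 4 * r * (4 * (16 * r + (1 + γ) ^ 2) + (1 + γ + γ ^ 2) ^ 2) ≤ (r ^ 2) ^ 2 := by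
    have e : (r ^ 2) ^ 2 - 4 * r * (4 * (16 * r + (1 + γ) ^ 2) + (1 + γ + γ ^ 2) ^ 2) =
        r * (r ^ 3 - 256 * r - 16 * (1 + γ) ^ 2 - 4 * (1 + γ + γ ^ 2) ^ 2) := by ring
    nlinarith [mul_pos hr0 hpos]
  linarith

/-- At the box point `⟨γ, ¼, 2, 1, 2⟩`: `N_j/δ_j = 4 · 4^j`. [folklore] -/
theorem scale_eq (γ : ℝ) (j : ℕ) :
    (((⟨γ, 1 / 4, 2, 1, 2⟩ : CascadeParams).N j : ℕ) : ℝ) / (⟨γ, 1 / 4, 2, 1, 2⟩ : CascadeParams).δ j = 4 * 4 ^ j := by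
  simp only [CascadeParams.N, CascadeParams.δ, one_mul, Nat.cast_pow, Nat.cast_ofNat]
  have h4 : (4 : ℝ) ^ j = 2 ^ j * 2 ^ j := by
    rw [show (4 : ℝ) = 2 * 2 by norm_num, mul_pow]
  rw [h4]
  field_simp

end Summit.AnomalousDissipation.AnomalousDissipation.Theorems.SawtoothPulseCascade.LipAgmon

end
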